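import Literature.Analysis.FluidPDE.NSHopfGalerkinExistence
import Literature.Analysis.FluidPDE.NSHopfLimit
import HarnessLib

/-!
# Hopf's Galerkin scheme for the UNFORCED Navier–Stokes equations on `T^d`:
  zero approximate forces and the uniform energy bound `½‖U n t‖² ≤ ½‖u₀‖²`

Trunk: FluidKinetic. Companion to `Literature/Analysis/FluidPDE/NSHopfGalerkinExistence`
(`exists_isHopfGalerkinScheme`: for a general force `f ∈ L²ₜₓ` the scheme carries SMOOTHED forces
`F n → f`, so at `f = 0` its witness does not say `F n = 0`). For the unforced problem
(Robinson–Rodrigo–Sadowski 2016, Thm. 4.4, which is printed at `f = 0`) the natural scheme has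
`F n = 0` literally and datum `U n 0 = P_{N n} u₀`; the Galerkin energy identity (RRS (4.6)–(4.7))
then reads `½‖U n t‖² + ν∫ₛᵗ‖∇U n‖² = ½‖U n s‖²`, so every approximation is energy-bounded by the
datum: `½‖U n t‖² ≤ ½‖P_n u₀‖² ≤ ½‖u₀‖²` (RRS (4.8) «‖u_n(t)‖ ≤ ‖u₀‖ for all t ≥ 0»; Lemma 4.1
`‖P_n u‖ ≤ ‖u‖`). This file records exactly that, in every dimension `d`, by re-running the
construction of `exists_isHopfGalerkinScheme` with zero force coefficients (the device of
`exists_isHopfGalerkinScheme_shear` in `NSHopfShearClass`, without the shear constraint).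

## Contents (all proved; no definitions, no named facts)

* `IsHopfGalerkinScheme.kineticEnergy_le_of_force_eq_zero`,
  `IsHopfGalerkinScheme.kineticEnergy_le_initial_of_force_eq_zero` — for ANY scheme for
  `(ν, f, u₀)` whose approximate forces vanish identically and `ν ≥ 0`:
  `kineticEnergy (U n t) ≤ kineticEnergy (U n s) ≤ kineticEnergy (U n 0)` for `0 ≤ s ≤ t`
  (energy identity + nonnegativity of the dissipation).
* `IsHopfGalerkinScheme.kineticEnergy_initial_le` — for ANY scheme: `kineticEnergy (U n 0) ≤
  kineticEnergy u₀` (energy form of the tree's `IsHopfGalerkinScheme.integral_norm_sq_zero_le`,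
  `NSHopfLimit`: Bessel for the Galerkin projection, RRS Lemma 4.1 with (4.4)).
* `IsHopfGalerkinScheme.kineticEnergy_le_datum_of_force_eq_zero` — the two combined:
  `kineticEnergy (U n t) ≤ kineticEnergy u₀` for `t ≥ 0` (RRS (4.8)).
* `exists_isHopfGalerkinScheme_unforced` — for `ν > 0` and `u₀ ∈ L²(T^d)` weakly divergence free:
  a Hopf–Galerkin scheme `(N, F, U)` for `(ν, 0, u₀)` with `N = id`, `F n = 0` for all `n`, and
  `U n 0 = fourierTruncate n u₀` (hence all of the above apply).

## Mathlib search

Mathlib (this pin) has no Galerkin / Navier–Stokes material (searched `Galerkin`, `LerayHopf`); the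
tree's `exists_isHopfGalerkinScheme` (general force) and `exists_isHopfGalerkinScheme_shear`
(zero force, shear class on `𝕋³`) are the two existing constructions; neither states the energy bound
by the datum as a clause; the datum-side Bessel bound `∫‖U n 0‖² ≤ ∫‖u₀‖²` is already
`IsHopfGalerkinScheme.integral_norm_sq_zero_le` (`NSHopfLimit`) and is reused, not restated.

## References

* J. C. Robinson, J. L. Rodrigo, W. Sadowski, *The three-dimensional Navier–Stokes equations*,
  CUP 2016, §4.1, Lemma 4.1, Thm. 4.4 Steps 1–2, (4.4)–(4.8), pp. 72–75 (`RobinsonRodrigoSadowski2016`).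
* P. Constantin, C. Foias, *Navier–Stokes Equations*, Chicago 1988, Ch. 8, (8.3)–(8.9).
* E. Hopf, Math. Nachr. 4 (1951), 213–231, §2 (`Hopf1951`).
-/

open MeasureTheory Set Filter Topology UnitAddTorus Metric Function
open scoped ENNReal NNReal InnerProductSpace

noncomputable section

namespace Literature.Analysis.FluidPDE

section NS

open FunctionSpaces.Torus Torus

variable {d : Type*} [Fintype d]

/-! ## Energy bounds valid for any Hopf–Galerkin scheme -/

namespace IsHopfGalerkinScheme

variable [DecidableEq d] {ν : ℝ} {f : ℝ → UnitAddTorus d → EuclideanSpace ℝ d}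
  {u₀ : UnitAddTorus d → EuclideanSpace ℝ d} {N : ℕ → ℕ}
  {F U : ℕ → ℝ → UnitAddTorus d → EuclideanSpace ℝ d}

/-- **Energy decay of unforced Galerkin approximations** (RRS 2016, (4.6)–(4.8): with `f = 0`,
`½ d/dt ‖u_n‖² = −ν‖∇u_n‖² ≤ 0`). If the approximate forces of a Hopf–Galerkin scheme vanish
identically and `ν ≥ 0`, then `kineticEnergy (U n t) ≤ kineticEnergy (U n s)` for `0 ≤ s ≤ t`.
[cite: RobinsonRodrigoSadowski2016, Thm. 4.4 (4.6)–(4.8) p.74] -/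
theorem kineticEnergy_le_of_force_eq_zero (hS : IsHopfGalerkinScheme ν f u₀ N F U) (hν : 0 ≤ ν)
    (hF : ∀ n, F n = 0) (n : ℕ) {s t : ℝ} (hs : 0 ≤ s) (hst : s ≤ t) :
    kineticEnergy (U n t) ≤ kineticEnergy (U n s) := by
  have h := hS.energy_eq n s t hs hst
  have hint : ∫ τ in s..t, ∫ x, ⟪F n τ x, U n τ x⟫_ℝ = 0 := by
    simp [hF n]
  rw [hint, add_zero] at h
  have hD : 0 ≤ ν * (∫⁻ τ in Ioo s t, eGradNormSq (U n τ)).toReal :=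
    mul_nonneg hν ENNReal.toReal_nonneg
  linarith

/-- Unforced Galerkin approximations are energy-bounded by their own datum:
`kineticEnergy (U n t) ≤ kineticEnergy (U n 0)` for `t ≥ 0` when `F ≡ 0` and `ν ≥ 0`.
[cite: RobinsonRodrigoSadowski2016, Thm. 4.4 (4.8) p.74] -/
theorem kineticEnergy_le_initial_of_force_eq_zero (hS : IsHopfGalerkinScheme ν f u₀ N F U)
    (hν : 0 ≤ ν) (hF : ∀ n, F n = 0) (n : ℕ) {t : ℝ} (ht : 0 ≤ t) :
    kineticEnergy (U n t) ≤ kineticEnergy (U n 0) :=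
  hS.kineticEnergy_le_of_force_eq_zero hν hF n le_rfl ht

/-- Bessel for the Galerkin datum, energy form: `kineticEnergy (U n 0) ≤ kineticEnergy u₀` for any
Hopf–Galerkin scheme with `u₀ ∈ L²` (the tree's `IsHopfGalerkinScheme.integral_norm_sq_zero_le` of
`NSHopfLimit`, RRS Lemma 4.1 `‖P_n u‖ ≤ ‖u‖` with (4.4), halved). [cite: RobinsonRodrigoSadowski2016, Lemma 4.1 p.72, (4.4) p.73] -/
theorem kineticEnergy_initial_le (hS : IsHopfGalerkinScheme ν f u₀ N F U)
    (hu₀ : MemLp u₀ 2 volume) (n : ℕ) : kineticEnergy (U n 0) ≤ kineticEnergy u₀ := by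
  unfold kineticEnergy
  exact mul_le_mul_of_nonneg_left (hS.integral_norm_sq_zero_le hu₀ n) (by norm_num)

/-- **Uniform energy bound of unforced Galerkin approximations** (RRS 2016, (4.8)
«‖u_n(t)‖ ≤ ‖u₀‖ for all t ≥ 0»): for a scheme with `F ≡ 0`, `ν ≥ 0`, `u₀ ∈ L²`,
`kineticEnergy (U n t) ≤ kineticEnergy u₀` for every `n` and `t ≥ 0`.
[cite: RobinsonRodrigoSadowski2016, Thm. 4.4 (4.8) p.74] -/
theorem kineticEnergy_le_datum_of_force_eq_zero (hS : IsHopfGalerkinScheme ν f u₀ N F U)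
    (hν : 0 ≤ ν) (hF : ∀ n, F n = 0) (hu₀ : MemLp u₀ 2 volume) (n : ℕ) {t : ℝ} (ht : 0 ≤ t) :
    kineticEnergy (U n t) ≤ kineticEnergy u₀ :=
  (hS.kineticEnergy_le_initial_of_force_eq_zero hν hF n ht).trans (hS.kineticEnergy_initial_le hu₀ n)

end IsHopfGalerkinScheme

/-! ## The unforced scheme with literally zero approximate forces -/

/-- **Existence of the Galerkin approximations for the unforced problem, with `F n = 0`**
(Robinson–Rodrigo–Sadowski 2016, Thm. 4.4 Steps 1–2 at `f = 0`; Constantin–Foias 1988, Ch. 8,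
(8.3)–(8.9); Hopf 1951, §2). Let `ν > 0` and let `u₀ ∈ L²(T^d; ℝ^d)` be weakly divergence free. Then
there is a Hopf–Galerkin scheme `(N, F, U)` for `(ν, 0, u₀)` (`IsHopfGalerkinScheme`) with `N n = n`,
`F n = 0` for every `n` (the real trigonometric polynomial with zero coefficients IS the zero field),
and `U n 0 = fourierTruncate n u₀`. Construction verbatim that of `exists_isHopfGalerkinScheme` with
the force coefficients `g n := 0` (`exists_galerkin_solution`, `galerkin_test_identity`,
`galerkin_energy_identity`, `coeffExt_zero`, `realTrigPoly_zero`). Consequently (lemmas above)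
`kineticEnergy (U n t) ≤ kineticEnergy u₀` for all `n`, `t ≥ 0`.
[cite: RobinsonRodrigoSadowski2016, Thm. 4.4 Steps 1–2 (4.3)–(4.8) pp.73–74] -/
theorem exists_isHopfGalerkinScheme_unforced [DecidableEq d] (ν : ℝ) (hν : 0 < ν)
    (u₀ : UnitAddTorus d → EuclideanSpace ℝ d) (hu₀ : MemLp u₀ 2 volume)
    (hdiv : FunctionSpaces.Torus.IsWeaklyDivFree u₀) :
    ∃ (N : ℕ → ℕ) (F U : ℕ → ℝ → UnitAddTorus d → EuclideanSpace ℝ d),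
      IsHopfGalerkinScheme ν 0 u₀ N F U ∧ (∀ n, N n = n) ∧ (∀ n, F n = 0) ∧
        ∀ n, U n 0 = fourierTruncate n u₀ := by
  have hS : ∀ n : ℕ, ∀ k ∈ freqBall (d := d) n, -k ∈ freqBall n := fun n =>
    neg_mem_freqBall_of_mem
  -- zero force coefficients
  set g' : (n : ℕ) → ℝ → (↥(freqBall (d := d) n) → EuclideanSpace ℂ d) :=
    fun n _ => 0 with hg'_def
  have hg'_real : ∀ n t, IsRealCoeff (g' n t) := fun n t k l _ => by
    simp only [hg'_def, Pi.zero_apply, FunctionSpaces.EuclideanSpace.conjVec_zero]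
  have hg'_cont : ∀ n, Continuous (g' n) := fun n => continuous_const
  have hg'_ext : ∀ n t, coeffExt (freqBall n) (g' n t) = 0 := fun n t => coeffExt_zero
  have hg'_poly : ∀ n t, realTrigPoly (freqBall n) (coeffExt (freqBall n) (g' n t)) = 0 := by
    intro n t; rw [hg'_ext n t, realTrigPoly_zero]
  -- the data of the Galerkin systems: `(û₀(k))_{|k| ≤ n}`
  set c₀ : (n : ℕ) → ↥(freqBall (d := d) n) → EuclideanSpace ℂ d :=
    fun n k => mFourierCoeff (FunctionSpaces.EuclideanSpace.complexify ∘ u₀) k with hc₀_def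
  have hc₀ : ∀ n, c₀ n ∈ galerkinSubspace (freqBall (d := d) n) := fun n =>
    ⟨isRealCoeff_mFourierCoeff (hu₀.integrable one_le_two),
      isSolenoidalCoeff_restrict (hdiv.isTransversal_mFourierCoeff hu₀ (freqBall n))⟩
  -- the global Galerkin solutions
  have hsol : ∀ n : ℕ, ∃ α : ℝ → ↥(freqBall (d := d) n) → EuclideanSpace ℂ d,
      α 0 = c₀ n ∧ (∀ t, α t ∈ galerkinSubspace (freqBall n)) ∧ ContinuousOn α (Ici 0) ∧
      ∀ T, ∀ t ∈ Icc 0 T, HasDerivWithinAt α (galerkinRHS (freqBall n) ν (g' n t) (α t))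
        (Icc 0 T) t := fun n =>
    exists_galerkin_solution ν hν.le (hS n) (hg'_cont n) (hg'_real n) (hc₀ n)
  choose α hα0 hαmem hαcont hαderiv using hsol
  -- the datum is the Fourier truncation
  have hU0 : ∀ n, realTrigPoly (freqBall n) (coeffExt (freqBall n) (α n 0)) =
      fourierTruncate n u₀ := by
    intro n
    rw [hα0 n, fourierTruncate_eq]
    exact realTrigPoly_coeffExt_restrict _
  -- band-limitation of Galerkin modes in `Finset` form
  have hband : ∀ {n : ℕ} {a : UnitAddTorus d → EuclideanSpace ℝ d}, IsGalerkinMode n a →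
      ∀ k ∉ freqBall (d := d) n, mFourierCoeff (FunctionSpaces.EuclideanSpace.complexify ∘ a) k = 0 :=
    fun ha k hk => ha.mFourierCoeff_eq_zero (not_mem_freqBall.1 hk)
  -- the scheme, with the force written as the ZERO field
  refine ⟨id, fun _ _ => 0, fun n t => realTrigPoly (freqBall n) (coeffExt (freqBall n) (α n t)),
    ?_, fun _ => rfl, fun _ => rfl, hU0⟩
  exact
    { tendsto_order := tendsto_id
      smooth_force := fun n => by
        change ContDiff ℝ _ (fun _ : ℝ × EuclideanSpace ℝ d => (0 : EuclideanSpace ℝ d))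
        exact contDiff_const
      tendsto_force := fun T hT => by
        refine tendsto_const_nhds.congr' (Eventually.of_forall fun n => ?_)
        simp
      continuousOn := fun n => continuousOn_stLift_realTrigPoly (hαcont n)
      isGalerkinMode := fun n t _ =>
        have h := galerkin_slice_props (hS n) (hαmem n t)
        ⟨h.1, h.2.1, fun k hk => h.2.2.2 k (not_mem_freqBall.2 hk)⟩
      isWeaklyDivFree := fun n t _ => (galerkin_slice_props (hS n) (hαmem n t)).2.2.1
      galerkin := fun n a ha s t hs hst => by
        have h := galerkin_test_identity ν (hS n) (hg'_cont n) (hg'_real n) (hαmem n) (hαderiv n)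
          ha.isSmooth ha.isDivFree (hband ha) hs hst
        simpa only [hg'_poly n, Pi.zero_apply, inner_zero_left] using h
      energy_eq := fun n s t hs hst => by
        have h := galerkin_energy_identity ν (hS n) (hg'_cont n) (hg'_real n) (hαmem n) (hαderiv n)
          hs hst
        simpa only [hg'_poly n, Pi.zero_apply, inner_zero_left] using h
      initial_inner := fun n a ha => by
        rw [hU0 n]
        exact integral_inner_fourierTruncate_eq hu₀ (ha.isSmooth.memLp 2) (hband ha)
      tendsto_initial := by
        have heq : (fun n => eLpNorm (realTrigPoly (freqBall n)
            (coeffExt (freqBall n) (α n 0)) - u₀) 2 volume) =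
            fun n => eLpNorm (fourierTruncate n u₀ - u₀) 2 volume := by
          funext n; rw [hU0 n]
        rw [heq]
        exact tendsto_eLpNorm_fourierTruncate_sub hu₀ }

/-- **The unforced scheme with its energy bound packaged** (RRS 2016, Thm. 4.4 Steps 1–2 and
(4.8) at `f = 0`): for `ν > 0`, `u₀ ∈ L²` weakly divergence free, a Hopf–Galerkin scheme for
`(ν, 0, u₀)` with `F ≡ 0` and `kineticEnergy (U n t) ≤ kineticEnergy u₀` for all `n`, `t ≥ 0`.
[cite: RobinsonRodrigoSadowski2016, Thm. 4.4 (4.8) p.74] -/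
theorem exists_isHopfGalerkinScheme_unforced_energy_le [DecidableEq d] (ν : ℝ) (hν : 0 < ν)
    (u₀ : UnitAddTorus d → EuclideanSpace ℝ d) (hu₀ : MemLp u₀ 2 volume)
    (hdiv : FunctionSpaces.Torus.IsWeaklyDivFree u₀) :
    ∃ (N : ℕ → ℕ) (F U : ℕ → ℝ → UnitAddTorus d → EuclideanSpace ℝ d),
      IsHopfGalerkinScheme ν 0 u₀ N F U ∧ (∀ n, F n = 0) ∧
        ∀ n t, 0 ≤ t → kineticEnergy (U n t) ≤ kineticEnergy u₀ := by
  obtain ⟨N, F, U, hSch, -, hF, -⟩ := exists_isHopfGalerkinScheme_unforced ν hν u₀ hu₀ hdiv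
  exact ⟨N, F, U, hSch, hF, fun n t ht =>
    hSch.kineticEnergy_le_datum_of_force_eq_zero hν.le hF hu₀ n ht⟩

end NS

end Literature.Analysis.FluidPDE
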